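import Literature.Topology.FourManifolds.DeepArcPlanar
import Literature.Topology.FourManifolds.ExitBend
import HarnessLib

/-!
# The model template: the scale-free hairpin of the deep track and the template loop

Topic `Literature/Topology/FourManifolds` (trunk T-4MAN). Fact seat
`provefact-Literature.Topology.FourManifolds.Knot.IsConnectedSum.isIsotopic` (Schubert's theorem),
geometric heart for rail knots, flattening step. The planar track of the deep arc
(`DeepArcPlanar.deepTrack`) is, as a function of the **tip clock** `q = tipClock t`, a fixed
(datum- and scale-free) `C^∞` curve `hairpin q` in the plane: the lower turn of level
`15/4 + 2 (q + 1)` for `q ≤ -3/8`, the tip `(4, q)` for `|q| ≤ 3/8`, the upper turn of level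
`15/4 + 2 (1 - q)` for `q ≥ 3/8` (`deepTrack_eq_hairpin`; the formulas overlap on `|q| ∈ [3/8, 5/8]`). This is the foreign part of the model
template of the flattening. The hairpin is regular (`deriv_hairpin_ne_zero`) and injective on
`[-15/8, 15/8]` (`injOn_hairpin`).

**The template loop** (`ModelTemplate.template σ`, period one): in blow-up coordinates of a
crossing, the model of a host loop is glued from five scale-free pieces of a global parameter
`p` of period `18` — the lower native piece `lowerModel σ (levLoOfP p)` (neck line `(α, -1, 0)`
blended into the lower model spike), the straight segment `cO σ + p • dLo σ`, the bent arc
`bendArc σ (1/8) p 1`, the upper native piece `upperModel σ (levHiOfP p)`, and the foreign piece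
`foreignModel (qOfP p) = (-(hairpin q)₀, -(hairpin q)₁, 0)` (the half-turned deep track of the
partner). Consecutive formulas agree on overlapping intervals (`lowerModel_eq_seg`,
`bendArc_eq_seg`, `bendArc_eq_ray`, `upperModel_eq_ray`, `upperModel_eq_foreign`,
`foreign_eq_lowerModel`), so `templateRaw σ` is `C^∞` (`contDiff_templateRaw`) and closes up
with period `18`; `template σ s := templateRaw σ (18 s)` periodised is `C^∞`, `1`-periodic
(`contDiff_template`, `periodic_template`), **simple** (`template_inj`, from the coordinate case
analysis `injOn_templateRaw`) and **regular** (`deriv_template_ne_zero`), for every `σ : ℝ`.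

Everything is proved; no named facts are introduced.

## References

Standard; all statements `[folklore]`.
-/

open scoped Manifold ContDiff Topology Real
open Function Set Metric Filter

noncomputable section

namespace Literature.Topology.FourManifolds

/-- Local notation: `𝔼 n` is the model Euclidean space `EuclideanSpace ℝ (Fin n)`. -/
local notation "𝔼 " n:arg => EuclideanSpace ℝ (Fin n)

open KnotsInBall

/-! ### The scale-free hairpin -/

/-- The level of the lower turn at tip clock `q`: `15/4 + 2 (q + 1)` (inverse of
`q = -1 + (a - 15/4)/2`). [folklore] -/
def levOfClockLo (q : ℝ) : ℝ := 15 / 4 + 2 * (q + 1)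

/-- The level of the upper turn at tip clock `q`: `15/4 + 2 (1 - q)`. [folklore] -/
def levOfClockHi (q : ℝ) : ℝ := 15 / 4 + 2 * (1 - q)

/-- `levOfClockLo` inverts the lower tip clock. [folklore] -/
theorem levOfClockLo_clock (a : ℝ) : levOfClockLo (-1 + (a - 15 / 4) / 2) = a := by rw [levOfClockLo]; ring

/-- `levOfClockHi` inverts the upper tip clock. [folklore] -/
theorem levOfClockHi_clock (a : ℝ) : levOfClockHi (1 - (a - 15 / 4) / 2) = a := by rw [levOfClockHi]; ring

/-- **THE HAIRPIN** (tip clock parameter `q`): lower turn, tip, upper turn. [folklore] -/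
def hairpin (q : ℝ) : 𝔼 2 :=
  if q ≤ -(3 / 8) then lowerTurn (levOfClockLo q) else if q < 3 / 8 then pt2 4 q else upperTurn (levOfClockHi q)

/-- Left of `-3/8` the hairpin is the lower turn. [folklore] -/
theorem hairpin_of_le {q : ℝ} (h : q ≤ -(3 / 8)) : hairpin q = lowerTurn (levOfClockLo q) := by simp [hairpin, h]

/-- Right of `3/8` the hairpin is the upper turn. [folklore] -/
theorem hairpin_of_ge {q : ℝ} (h : 3 / 8 ≤ q) : hairpin q = upperTurn (levOfClockHi q) := by
  simp [hairpin, not_le.2 (show -(3 / 8 : ℝ) < q by linarith), not_lt.2 h]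

/-- On `(-3/8, 3/8)` the hairpin is the tip. [folklore] -/
theorem hairpin_of_mem {q : ℝ} (h : q ∈ Ioo (-(3 / 8) : ℝ) (3 / 8)) : hairpin q = pt2 4 q := by
  simp [hairpin, not_le.2 h.1, h.2]

/-- **Near the lower mark both formulas are the tip**: on `[-5/8, 3/8)` the hairpin is `(4, q)`
(the lower turn of level `≥ 9/2` is the tip). [folklore] -/
theorem hairpin_eq_tip_of_mem {q : ℝ} (h : q ∈ Ico (-(5 / 8) : ℝ) (3 / 8)) : hairpin q = pt2 4 q := by
  rcases le_or_gt q (-(3 / 8)) with h1 | h1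
  · rw [hairpin_of_le h1, lowerTurn_of_ge (by rw [levOfClockLo]; linarith [h.1])]
    congr 1; rw [levOfClockLo]; ring
  · exact hairpin_of_mem ⟨h1, h.2⟩

/-- **Near the upper mark both formulas are the tip**: on `(-3/8, 5/8]`. [folklore] -/
theorem hairpin_eq_tip_of_mem' {q : ℝ} (h : q ∈ Ioc (-(3 / 8) : ℝ) (5 / 8)) : hairpin q = pt2 4 q := by
  rcases lt_or_ge q (3 / 8) with h1 | h1
  · exact hairpin_of_mem ⟨h.1, h1⟩
  · rw [hairpin_of_ge h1, upperTurn_of_ge (by rw [levOfClockHi]; linarith [h.2])]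
    congr 1; rw [levOfClockHi]; ring

/-- **The hairpin is `C^∞`.** [folklore] -/
theorem contDiff_hairpin : ContDiff ℝ ∞ hairpin := by
  have hlo : ContDiff ℝ ∞ (fun q ↦ lowerTurn (levOfClockLo q)) :=
    contDiff_lowerTurn.comp (contDiff_const.add (contDiff_const.mul (contDiff_id.add contDiff_const)))
  have hhi : ContDiff ℝ ∞ (fun q ↦ upperTurn (levOfClockHi q)) :=
    contDiff_upperTurn.comp (contDiff_const.add (contDiff_const.mul (contDiff_const.sub contDiff_id)))
  have htip : ContDiff ℝ ∞ (fun q : ℝ ↦ (pt2 4 q : 𝔼 2)) := by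
    have : (fun q : ℝ ↦ (pt2 4 q : 𝔼 2)) = fun q ↦ (pt2 4 0 : 𝔼 2) + q • (pt2 0 1 : 𝔼 2) := by
      funext q; ext i; fin_cases i <;> simp [pt2]
    rw [this]; exact contDiff_const.add (contDiff_id.smul contDiff_const)
  refine contDiff_iff_contDiffAt.2 fun q ↦ ?_
  rcases lt_trichotomy q (-(1 / 2)) with h | h | h
  · -- left: the lower turn
    refine hlo.contDiffAt.congr_of_eventuallyEq ?_
    filter_upwards [Iio_mem_nhds (show q < -(3 / 8) by linarith)] with r hr using hairpin_of_le hr.le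
  · subst h
    refine htip.contDiffAt.congr_of_eventuallyEq ?_
    filter_upwards [Ioo_mem_nhds (show (-(5 / 8) : ℝ) < -(1 / 2) by norm_num) (show (-(1 / 2) : ℝ) < 3 / 8 by norm_num)] with r hr
      using hairpin_eq_tip_of_mem ⟨hr.1.le, hr.2⟩
  rcases lt_trichotomy q (1 / 2) with h' | h' | h'
  · refine htip.contDiffAt.congr_of_eventuallyEq ?_
    filter_upwards [Ioo_mem_nhds h h'] with r hr
    rcases lt_or_ge r (3 / 8) with h2 | h2
    · exact hairpin_eq_tip_of_mem ⟨by linarith [hr.1], h2⟩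
    · exact hairpin_eq_tip_of_mem' ⟨by linarith, by linarith [hr.2]⟩
  · subst h'
    refine htip.contDiffAt.congr_of_eventuallyEq ?_
    filter_upwards [Ioo_mem_nhds (show (-(3 / 8) : ℝ) < 1 / 2 by norm_num) (show (1 / 2 : ℝ) < 5 / 8 by norm_num)] with r hr
      using hairpin_eq_tip_of_mem' ⟨hr.1, hr.2.le⟩
  · refine hhi.contDiffAt.congr_of_eventuallyEq ?_
    filter_upwards [Ioi_mem_nhds (show (3 / 8 : ℝ) < q by linarith)] with r hr using hairpin_of_ge hr.le

/-! ### The deep track is the hairpin of the tip clock -/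

namespace BandData

variable {A B K : Knot} {avoid : Set (Metric.sphere (0 : EuclideanSpace ℝ (Fin 4)) 1)} (b : BandData A B K avoid)
  {κ : ℝ} (hκ : 0 < κ) (h7 : 7 * κ ≤ b.gapLo) (h7' : 7 * κ ≤ b.gapHi)

/-- The level `7` lies in `[-7, 7]`. [folklore] -/
theorem seven_mem7' : (7 : ℝ) ∈ Icc (-7 : ℝ) 7 := ⟨by norm_num, by norm_num⟩

/-- **THE DEEP TRACK IS THE HAIRPIN OF THE TIP CLOCK** on the deep range `[parLo 7, parHi 7]`.
[folklore] -/
theorem deepTrack_eq_hairpin {t : ℝ} (ht : t ∈ Icc (b.parLo hκ h7 seven_mem7') (b.parHi hκ h7' seven_mem7')) :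
    b.deepTrack hκ h7 h7' t = hairpin (b.tipClock hκ h7 h7' t) := by
  rcases le_or_gt t (b.parLo hκ h7 five_mem) with h1 | h1
  · -- lower turn: `q = -1 + (αLo - 15/4)/2 ≤ -3/8`
    have hc : t ∈ Icc (b.tcLo - b.epsLo / 8) (b.tcLo + b.epsLo / 8) :=
      ⟨by linarith [ht.1, (b.parLo_mem_core hκ h7 seven_mem7').1], by linarith [(b.parLo_mem_core hκ h7 five_mem).2]⟩
    have ha : b.alphaLo κ t ≤ 5 := (b.alphaLo_le_iff' hκ h7 five_mem hc).2 h1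
    rw [b.deepTrack_of_le hκ h7 h7' h1, b.tipClock_of_le hκ h7 h7' h1, hairpin_of_le (by linarith), levOfClockLo_clock]
  rcases lt_or_ge t (b.parHi hκ h7' five_mem) with h2 | h2
  · rw [b.deepTrack_of_mem hκ h7 h7' ⟨h1, h2⟩]
    have hq := b.tipClock_mem hκ h7 h7' ⟨h1.le, h2.le⟩
    rcases lt_or_ge (b.tipClock hκ h7 h7' t) (3 / 8) with h3 | h3
    · exact (hairpin_eq_tip_of_mem ⟨by linarith [hq.1], h3⟩).symm
    · exact (hairpin_eq_tip_of_mem' ⟨by linarith [hq.1], by linarith [hq.2]⟩).symm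
  · have hc : t ∈ Icc (b.tcHi - b.epsHi / 8) (b.tcHi + b.epsHi / 8) :=
      ⟨by linarith [(b.parHi_mem_core hκ h7' five_mem).1], by linarith [ht.2, (b.parHi_mem_core hκ h7' seven_mem7').2]⟩
    have ha : b.alphaHi κ t ≤ 5 := (b.alphaHi_le_iff' hκ h7' five_mem hc).2 h2
    rw [b.deepTrack_of_ge hκ h7 h7' h2, b.tipClock_of_ge hκ h7 h7' h2, hairpin_of_ge (by linarith), levOfClockHi_clock]

end BandData

/-! ### Regularity and injectivity of the hairpin -/

/-- The second coordinate classifies hairpin points: `≤ -3/8` on the lower turn, in `(-3/8, 3/8)`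
on the tip, `≥ 3/8` on the upper turn. [folklore] -/
theorem hairpin_apply_one (q : ℝ) :
    (q ≤ -(3 / 8) → hairpin q 1 ≤ -(3 / 8)) ∧ (q ∈ Ioo (-(3 / 8) : ℝ) (3 / 8) → hairpin q 1 = q) ∧
      (3 / 8 ≤ q → 3 / 8 ≤ hairpin q 1) := by
  refine ⟨fun h ↦ ?_, fun h ↦ by rw [hairpin_of_mem h]; rfl, fun h ↦ ?_⟩
  · rw [hairpin_of_le h, lowerTurn, pt2_apply_one]
    exact (turnV_mem (show levOfClockLo q ≤ 5 by rw [levOfClockLo]; linarith)).2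
  · rw [hairpin_of_ge h, upperTurn, pt2_apply_one]
    have := (turnV_mem (show levOfClockHi q ≤ 5 by rw [levOfClockHi]; linarith)).2
    linarith

/-- **The hairpin is injective on `[-15/8, 15/8]`.** [folklore] -/
theorem injOn_hairpin : InjOn hairpin (Icc (-(15 / 8) : ℝ) (15 / 8)) := by
  intro q hq q' hq' he
  obtain ⟨l1, t1, u1⟩ := hairpin_apply_one q
  obtain ⟨l2, t2, u2⟩ := hairpin_apply_one q'
  have he1 : hairpin q 1 = hairpin q' 1 := by rw [he]
  rcases le_or_gt q (-(3 / 8)) with h1 | h1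
  · -- `q` on the lower turn: so is `q'`
    have h1' : q' ≤ -(3 / 8) := by
      by_contra h; push Not at h
      rcases lt_or_ge q' (3 / 8) with h3 | h3
      · have := t2 ⟨h, h3⟩; have := l1 h1; linarith
      · have := u2 h3; have := l1 h1; linarith
    rw [hairpin_of_le h1, hairpin_of_le h1'] at he
    have := injOn_lowerTurn (show levOfClockLo q ≤ 5 by rw [levOfClockLo]; linarith) (show levOfClockLo q' ≤ 5 by rw [levOfClockLo]; linarith) he
    simp only [levOfClockLo] at this; linarith
  rcases lt_or_ge q (3 / 8) with h2 | h2
  · -- `q` on the tip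
    have ht : hairpin q 1 = q := t1 ⟨h1, h2⟩
    rcases le_or_gt q' (-(3 / 8)) with h3 | h3
    · have := l2 h3; linarith
    rcases lt_or_ge q' (3 / 8) with h4 | h4
    · have := t2 ⟨h3, h4⟩; linarith
    · have := u2 h4; linarith
  · -- `q` on the upper turn
    have h2' : 3 / 8 ≤ q' := by
      by_contra h; push Not at h
      rcases le_or_gt q' (-(3 / 8)) with h3 | h3
      · have := l2 h3; have := u1 h2; linarith
      · have := t2 ⟨h3, h⟩; have := u1 h2; linarith
    rw [hairpin_of_ge h2, hairpin_of_ge h2'] at he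
    have := injOn_upperTurn (show levOfClockHi q ≤ 5 by rw [levOfClockHi]; linarith) (show levOfClockHi q' ≤ 5 by rw [levOfClockHi]; linarith) he
    simp only [levOfClockHi] at this; linarith

/-- **The hairpin is regular.** [folklore] -/
theorem deriv_hairpin_ne_zero (q : ℝ) : deriv hairpin q ≠ 0 := by
  have hlo : ∀ q, HasDerivAt (fun q ↦ lowerTurn (levOfClockLo q)) ((2 : ℝ) • deriv lowerTurn (levOfClockLo q)) q := fun q ↦ by
    have h1 : HasDerivAt levOfClockLo 2 q := by
      have e : levOfClockLo = fun x ↦ 15 / 4 + 2 * (x + 1) := rfl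
      rw [e]
      simpa using (((hasDerivAt_id q).add_const 1).const_mul 2).const_add (15 / 4)
    exact (contDiff_lowerTurn.differentiable (by simp) _).hasDerivAt.scomp q h1
  have hhi : ∀ q, HasDerivAt (fun q ↦ upperTurn (levOfClockHi q)) ((-2 : ℝ) • deriv upperTurn (levOfClockHi q)) q := fun q ↦ by
    have h1 : HasDerivAt levOfClockHi (-2) q := by
      have e : levOfClockHi = fun x ↦ 15 / 4 + 2 * (1 - x) := rfl
      rw [e]
      simpa using (((hasDerivAt_id q).const_sub 1).const_mul 2).const_add (15 / 4)
    exact (contDiff_upperTurn.differentiable (by simp) _).hasDerivAt.scomp q h1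
  have htip : ∀ q : ℝ, HasDerivAt (fun q : ℝ ↦ (pt2 4 q : 𝔼 2)) (pt2 0 1) q := fun q ↦ by
    have e : (fun q : ℝ ↦ (pt2 4 q : 𝔼 2)) = fun q ↦ (pt2 4 0 : 𝔼 2) + q • (pt2 0 1 : 𝔼 2) := by
      funext q; ext i; fin_cases i <;> simp [pt2]
    rw [e]; simpa using ((hasDerivAt_id q).smul_const (pt2 0 1 : 𝔼 2)).const_add (pt2 4 0 : 𝔼 2)
  have hne : (pt2 0 1 : 𝔼 2) ≠ 0 := fun h ↦ by have := congrArg (· 1) h; simp at this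
  rcases lt_or_ge q (-(1 / 2)) with h1 | h1
  · have hd : HasDerivAt hairpin ((2 : ℝ) • deriv lowerTurn (levOfClockLo q)) q :=
      (hlo q).congr_of_eventuallyEq (by filter_upwards [Iio_mem_nhds (show q < -(3 / 8) by linarith)] with r hr using hairpin_of_le hr.le)
    rw [hd.deriv]; exact smul_ne_zero two_ne_zero (deriv_lowerTurn_ne_zero _)
  rcases le_or_gt q (1 / 2) with h2 | h2
  · have hd : HasDerivAt hairpin (pt2 0 1) q := (htip q).congr_of_eventuallyEq (by
        filter_upwards [Ioo_mem_nhds (show (-(5 / 8) : ℝ) < q by linarith) (show q < 5 / 8 by linarith)] with r hr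
        rcases lt_or_ge r (3 / 8) with h3 | h3
        · exact hairpin_eq_tip_of_mem ⟨hr.1.le, h3⟩
        · exact hairpin_eq_tip_of_mem' ⟨by linarith, hr.2.le⟩)
    rw [hd.deriv]; exact hne
  · have hd : HasDerivAt hairpin ((-2 : ℝ) • deriv upperTurn (levOfClockHi q)) q :=
      (hhi q).congr_of_eventuallyEq (by filter_upwards [Ioi_mem_nhds (show (3 / 8 : ℝ) < q by linarith)] with r hr using hairpin_of_ge hr.le)
    rw [hd.deriv]; exact smul_ne_zero (by norm_num) (deriv_upperTurn_ne_zero _)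

/-- **The first coordinate of the hairpin is at least `2`** on `[-15/8, 15/8]`, and `> 2` inside.
[folklore] -/
theorem two_le_hairpin_apply_zero {q : ℝ} (hq : q ∈ Icc (-(15 / 8) : ℝ) (15 / 8)) :
    2 ≤ hairpin q 0 ∧ (q ∈ Ioo (-(15 / 8) : ℝ) (15 / 8) → 2 < hairpin q 0) := by
  rcases le_or_gt q (-(3 / 8)) with h1 | h1
  · rw [hairpin_of_le h1, lowerTurn, pt2_apply_zero]
    have ha : levOfClockLo q ≤ 5 := by rw [levOfClockLo]; linarith
    have ha2 : 2 ≤ levOfClockLo q := by rw [levOfClockLo]; linarith [hq.1]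
    rcases le_or_gt (levOfClockLo q) 4 with h4 | h4
    · have := (turnX_mem_of_le h4).1
      refine ⟨by linarith, fun hq' ↦ ?_⟩
      have : 2 < levOfClockLo q := by rw [levOfClockLo]; linarith [hq'.1]
      linarith
    · have := (turnX_le_of_ge h4.le).1
      exact ⟨by linarith, fun _ ↦ by linarith⟩
  rcases lt_or_ge q (3 / 8) with h2 | h2
  · rw [hairpin_of_mem ⟨h1, h2⟩, pt2_apply_zero]; exact ⟨by norm_num, fun _ ↦ by norm_num⟩
  · rw [hairpin_of_ge h2, upperTurn, pt2_apply_zero]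
    have ha2 : 2 ≤ levOfClockHi q := by rw [levOfClockHi]; linarith [hq.2]
    rcases le_or_gt (levOfClockHi q) 4 with h4 | h4
    · have := (turnX_mem_of_le h4).1
      refine ⟨by linarith, fun hq' ↦ ?_⟩
      have : 2 < levOfClockHi q := by rw [levOfClockHi]; linarith [hq'.2]
      linarith
    · have := (turnX_le_of_ge h4.le).1
      exact ⟨by linarith, fun _ ↦ by linarith⟩


/-! ### The native model pieces (scale-free, blow-up coordinates) -/

namespace ModelTemplate

open ExitBend

/-- The lower level at extended clock `p`: `1/4 + (3/4)(p + 1)` (inverse of the affine ray clock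
`p = (4/3)(α - 1/4) - 1`). [folklore] -/
def levLoOfP (p : ℝ) : ℝ := 1 / 4 + 3 / 4 * (p + 1)

/-- The upper level at extended clock `p`: `1/4 - (3/4)(p - 1)`. [folklore] -/
def levHiOfP (p : ℝ) : ℝ := 1 / 4 - 3 / 4 * (p - 1)

/-- The tip clock at parameter `p` of the foreign zone: `(3/8)(p - 19/3) - 1` (inverse of
`p = 19/3 + (8/3)(q + 1)`). [folklore] -/
def qOfP (p : ℝ) : ℝ := 3 / 8 * (p - 19 / 3) - 1

/-- **The lower native model**: neck line `(α, -1, 0)` blended by the spike bump into the lower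
model path. [folklore] -/
def lowerModel (σ α : ℝ) : 𝔼 3 := (1 - spikeBump α) • pt3 α (-1) 0 + spikeBump α • modelLo σ α

/-- **The upper native model.** [folklore] -/
def upperModel (σ α : ℝ) : 𝔼 3 := (1 - spikeBump α) • pt3 α 1 0 + spikeBump α • modelHi σ α

/-- **The foreign model**: the flipped hairpin `(-h₀, -h₁, 0)`. [folklore] -/
def foreignModel (q : ℝ) : 𝔼 3 := pt3 (-(hairpin q 0)) (-(hairpin q 1)) 0

/-- **THE RAW TEMPLATE** (one period `[-4, 14]` of the parameter `p`, extended by the end formulas):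
lower native model, straight segment, bend arc, upper native model, foreign hairpin. [folklore] -/
def templateRaw (σ p : ℝ) : 𝔼 3 :=
  if p ≤ -(7 / 8) then lowerModel σ (levLoOfP p)
  else if p ≤ 7 / 16 then cO σ + p • dLo σ
  else if p ≤ 11 / 12 then bendArc σ (1 / 8) p 1
  else if p ≤ 4 then upperModel σ (levHiOfP p)
  else foreignModel (qOfP p)

/-! ### Smoothness of the pieces -/

/-- `pt3` as an affine map in the first coordinate with fixed other coordinates. [folklore] -/
theorem pt3_eq_lineMap (α y z : ℝ) : (pt3 α y z : 𝔼 3) = pt3 0 y z + α • pt3 1 0 0 := by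
  ext i; fin_cases i <;> simp [pt3]

/-- The lower native model is `C^∞`. [folklore] -/
theorem contDiff_lowerModel (σ : ℝ) : ContDiff ℝ ∞ (lowerModel σ) := by
  have h1 : ContDiff ℝ ∞ (fun α : ℝ ↦ (pt3 α (-1) 0 : 𝔼 3)) := by
    have : (fun α : ℝ ↦ (pt3 α (-1) 0 : 𝔼 3)) = fun α ↦ pt3 0 (-1) 0 + α • pt3 1 0 0 := funext fun α ↦ pt3_eq_lineMap α (-1) 0
    rw [this]; exact contDiff_const.add (contDiff_id.smul contDiff_const)
  exact ((contDiff_const.sub contDiff_spikeBump).smul h1).add (contDiff_spikeBump.smul (contDiff_modelLo σ))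

/-- The upper native model is `C^∞`. [folklore] -/
theorem contDiff_upperModel (σ : ℝ) : ContDiff ℝ ∞ (upperModel σ) := by
  have h1 : ContDiff ℝ ∞ (fun α : ℝ ↦ (pt3 α 1 0 : 𝔼 3)) := by
    have : (fun α : ℝ ↦ (pt3 α 1 0 : 𝔼 3)) = fun α ↦ pt3 0 1 0 + α • pt3 1 0 0 := funext fun α ↦ pt3_eq_lineMap α 1 0
    rw [this]; exact contDiff_const.add (contDiff_id.smul contDiff_const)
  exact ((contDiff_const.sub contDiff_spikeBump).smul h1).add (contDiff_spikeBump.smul (contDiff_modelHi σ))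

/-- The foreign model is `C^∞`. [folklore] -/
theorem contDiff_foreignModel : ContDiff ℝ ∞ foreignModel := by
  have h0 : ContDiff ℝ ∞ fun q ↦ hairpin q 0 := contDiff_euclidean.1 contDiff_hairpin 0
  have h1 : ContDiff ℝ ∞ fun q ↦ hairpin q 1 := contDiff_euclidean.1 contDiff_hairpin 1
  have e : foreignModel = fun q ↦ (-(hairpin q 0)) • (pt3 1 0 0 : 𝔼 3) + (-(hairpin q 1)) • pt3 0 1 0 := by
    funext q; ext i; fin_cases i <;> simp [foreignModel, pt3]
  rw [e]; exact (h0.neg.smul contDiff_const).add (h1.neg.smul contDiff_const)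

/-- The bend arc at time one is `C^∞` in the radius on `(1/16, ∞)` (away from the inner annulus of
the cut-off of radius `1/8`)... in fact everywhere: it is a smooth expression. [folklore] -/
theorem contDiff_bendArc_one (σ : ℝ) : ContDiff ℝ ∞ fun p ↦ bendArc σ (1 / 8) p 1 := by
  have hc : ContDiff ℝ ∞ fun p : ℝ ↦ annulusCut (1 / 8) (p ^ 2) := by
    unfold annulusCut
    exact ((contDiff_smoothStep _ _).comp (contDiff_id.pow 2)).mul (contDiff_const.sub ((contDiff_smoothStep _ _).comp (contDiff_id.pow 2)))
  have hx : ContDiff ℝ ∞ fun p : ℝ ↦ π / 2 * annulusCut (1 / 8) (p ^ 2) * 1 := (contDiff_const.mul hc).mul contDiff_const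
  unfold bendArc
  exact (contDiff_const.add ((contDiff_id.mul (Real.contDiff_sin.comp hx)).smul contDiff_const)).add
    ((contDiff_id.mul (Real.contDiff_cos.comp hx)).smul contDiff_const)

/-! ### The overlap identities -/

/-- **Lower overlap** (`p ∈ [-1, -3/4]`, levels `[1/4, 7/16]`): the lower native model is the
straight segment. [folklore] -/
theorem lowerModel_eq_seg (σ : ℝ) {p : ℝ} (hp : p ∈ Icc (-1 : ℝ) (-(3 / 4))) :
    lowerModel σ (levLoOfP p) = cO σ + p • dLo σ := by
  have hα : levLoOfP p ∈ Icc (1 / 4 : ℝ) (7 / 16) := by simp only [levLoOfP, mem_Icc]; constructor <;> linarith [hp.1, hp.2]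
  rw [lowerModel, spikeBump_eq_one ⟨hα.1, by linarith [hα.2]⟩, sub_self, zero_smul, zero_add, one_smul, modelLo,
    spikeProfile_of_le (by linarith [hα.2])]
  ext i; fin_cases i <;> simp [pt3, cO, dLo, levLoOfP] <;> ring

/-- **Segment–arc overlap** (`p ∈ [1/4, 1/2]`): the bend arc of radius `1/8` at time one is the
straight segment. [folklore] -/
theorem bendArc_eq_seg (σ : ℝ) {p : ℝ} (hp : p ∈ Icc (1 / 4 : ℝ) (1 / 2)) : bendArc σ (1 / 8) p 1 = cO σ + p • dLo σ :=
  bendArc_one_of_eq_one σ (annulusCut_of_mem (rA := 1 / 8) (x := p ^ 2) (by norm_num) ⟨by nlinarith [hp.1], by nlinarith [hp.1, hp.2]⟩)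

/-- **Arc–upper overlap** (`p ∈ [3/4, 1]`): the bend arc is the upper ray `cO + p dHi`. [folklore] -/
theorem bendArc_eq_ray (σ : ℝ) {p : ℝ} (hp : p ∈ Icc (3 / 4 : ℝ) 1) : bendArc σ (1 / 8) p 1 = cO σ + p • dHi σ :=
  bendArc_of_eq_zero σ (annulusCut_of_ge (rA := 1 / 8) (x := p ^ 2) (by nlinarith [hp.1])) 1

/-- **Upper overlap** (`p ∈ [5/6, 1]`, levels `[1/4, 3/8]`): the upper native model is the upper ray.
[folklore] -/
theorem upperModel_eq_ray (σ : ℝ) {p : ℝ} (hp : p ∈ Icc (5 / 6 : ℝ) 1) : upperModel σ (levHiOfP p) = cO σ + p • dHi σ := by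
  have hα : levHiOfP p ∈ Icc (1 / 4 : ℝ) (3 / 8) := by simp only [levHiOfP, mem_Icc]; constructor <;> linarith [hp.1, hp.2]
  rw [upperModel, spikeBump_eq_one ⟨hα.1, by linarith [hα.2]⟩, sub_self, zero_smul, zero_add, one_smul, modelHi,
    spikeProfile_of_le (by linarith [hα.2])]
  ext i; fin_cases i <;> simp [pt3, cO, dHi, levHiOfP] <;> ring

/-- **Upper junction overlap** (`p ∈ [8/3, 6]`): the upper native model (upper neck line at level
`levHiOfP p ≤ -1`) is the foreign model (lower turn of the flipped hairpin). [folklore] -/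
theorem upperModel_eq_foreign (σ : ℝ) {p : ℝ} (hp : p ∈ Icc (8 / 3 : ℝ) 6) : upperModel σ (levHiOfP p) = foreignModel (qOfP p) := by
  have hα : levHiOfP p ≤ 1 / 8 := by simp only [levHiOfP]; linarith [hp.1]
  have hq : qOfP p ≤ -(3 / 8) := by simp only [qOfP]; linarith [hp.2]
  have ha : levOfClockLo (qOfP p) ≤ 7 / 2 := by simp only [levOfClockLo, qOfP]; linarith [hp.2]
  have hv : levOfClockLo (qOfP p) ≤ 15 / 4 := by linarith
  rw [upperModel, spikeBump_eq_zero_of_le hα, sub_zero, one_smul, zero_smul, add_zero, foreignModel, hairpin_of_le hq,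
    lowerTurn, turnX_of_le ha, turnV_of_le hv]
  ext i; fin_cases i <;> (simp [levHiOfP, levOfClockLo, qOfP]; try ring)

/-- **The seam identity**: one period on, the foreign model (upper turn of the flipped hairpin) is
the lower native model (`p ∈ [-6, -7/6]`). [folklore] -/
theorem foreign_eq_lowerModel (σ : ℝ) {p : ℝ} (hp : p ∈ Icc (-6 : ℝ) (-(7 / 6))) :
    foreignModel (qOfP (p + 18)) = lowerModel σ (levLoOfP p) := by
  have hα : levLoOfP p ≤ 1 / 8 := by simp only [levLoOfP]; linarith [hp.2]
  have hq : 3 / 8 ≤ qOfP (p + 18) := by simp only [qOfP]; linarith [hp.1]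
  have ha : levOfClockHi (qOfP (p + 18)) ≤ 7 / 2 := by simp only [levOfClockHi, qOfP]; linarith [hp.1]
  have hv : levOfClockHi (qOfP (p + 18)) ≤ 15 / 4 := by linarith
  rw [lowerModel, spikeBump_eq_zero_of_le hα, sub_zero, one_smul, zero_smul, add_zero, foreignModel, hairpin_of_ge hq,
    upperTurn, turnX_of_le ha, turnV_of_le hv]
  ext i; fin_cases i <;> (simp [levLoOfP, levOfClockHi, qOfP]; try ring)

/-! ### Zone formulas and smoothness of the raw template -/

/-- Zone 1: `p ≤ -7/8`. [folklore] -/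
theorem templateRaw_of_le {σ p : ℝ} (h : p ≤ -(7 / 8)) : templateRaw σ p = lowerModel σ (levLoOfP p) := by simp [templateRaw, h]

/-- Zone 2 (with the overlap): `p ∈ [-1, 7/16]`. [folklore] -/
theorem templateRaw_of_mem_seg {σ p : ℝ} (h : p ∈ Icc (-1 : ℝ) (7 / 16)) : templateRaw σ p = cO σ + p • dLo σ := by
  rcases le_or_gt p (-(7 / 8)) with h1 | h1
  · rw [templateRaw_of_le h1, lowerModel_eq_seg σ ⟨h.1, by linarith⟩]
  · simp [templateRaw, not_le.2 h1, h.2]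

/-- Zone 3 (with the overlaps): `p ∈ [1/4, 1]`. [folklore] -/
theorem templateRaw_of_mem_arc {σ p : ℝ} (h : p ∈ Icc (1 / 4 : ℝ) 1) : templateRaw σ p = bendArc σ (1 / 8) p 1 := by
  rcases le_or_gt p (7 / 16) with h1 | h1
  · rw [templateRaw_of_mem_seg ⟨by linarith [h.1], h1⟩, bendArc_eq_seg σ ⟨h.1, by linarith⟩]
  rcases le_or_gt p (11 / 12) with h2 | h2
  · simp [templateRaw, not_le.2 (show -(7 / 8 : ℝ) < p by linarith), not_le.2 h1, h2]
  · have : templateRaw σ p = upperModel σ (levHiOfP p) := by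
      simp [templateRaw, not_le.2 (show -(7 / 8 : ℝ) < p by linarith), not_le.2 h1, not_le.2 h2, show p ≤ 4 by linarith [h.2]]
    rw [this, upperModel_eq_ray σ ⟨by linarith, h.2⟩, bendArc_eq_ray σ ⟨by linarith, h.2⟩]

/-- Zone 4 (with the overlaps): `p ∈ [5/6, 6]`. [folklore] -/
theorem templateRaw_of_mem_upper {σ p : ℝ} (h : p ∈ Icc (5 / 6 : ℝ) 6) : templateRaw σ p = upperModel σ (levHiOfP p) := by
  rcases le_or_gt p (11 / 12) with h1 | h1
  · rw [templateRaw_of_mem_arc ⟨by linarith [h.1], by linarith⟩, bendArc_eq_ray σ ⟨by linarith [h.1], by linarith⟩,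
      upperModel_eq_ray σ ⟨h.1, by linarith⟩]
  rcases le_or_gt p 4 with h2 | h2
  · simp [templateRaw, not_le.2 (show -(7 / 8 : ℝ) < p by linarith [h.1]), not_le.2 (show (7 / 16 : ℝ) < p by linarith [h.1]), not_le.2 h1, h2]
  · have : templateRaw σ p = foreignModel (qOfP p) := by
      simp [templateRaw, not_le.2 (show -(7 / 8 : ℝ) < p by linarith [h.1]), not_le.2 (show (7 / 16 : ℝ) < p by linarith [h.1]),
        not_le.2 h1, not_le.2 h2]
    rw [this, upperModel_eq_foreign σ ⟨by linarith, h.2⟩]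

/-- Zone 5 (with the overlap): `8/3 ≤ p`. [folklore] -/
theorem templateRaw_of_ge {σ p : ℝ} (h : 8 / 3 ≤ p) : templateRaw σ p = foreignModel (qOfP p) := by
  rcases le_or_gt p 4 with h1 | h1
  · rw [templateRaw_of_mem_upper ⟨by linarith, by linarith⟩, upperModel_eq_foreign σ ⟨h, by linarith⟩]
  · simp [templateRaw, not_le.2 (show -(7 / 8 : ℝ) < p by linarith), not_le.2 (show (7 / 16 : ℝ) < p by linarith),
      not_le.2 (show (11 / 12 : ℝ) < p by linarith), not_le.2 h1]

/-- **THE RAW TEMPLATE IS `C^∞`.** [folklore] -/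
theorem contDiff_templateRaw (σ : ℝ) : ContDiff ℝ ∞ (templateRaw σ) := by
  have hlo : ContDiff ℝ ∞ fun p ↦ lowerModel σ (levLoOfP p) :=
    (contDiff_lowerModel σ).comp (contDiff_const.add (contDiff_const.mul (contDiff_id.add contDiff_const)))
  have hseg : ContDiff ℝ ∞ fun p : ℝ ↦ cO σ + p • dLo σ := contDiff_const.add (contDiff_id.smul contDiff_const)
  have harc := contDiff_bendArc_one σ
  have hup : ContDiff ℝ ∞ fun p ↦ upperModel σ (levHiOfP p) :=
    (contDiff_upperModel σ).comp (contDiff_const.sub (contDiff_const.mul (contDiff_id.sub contDiff_const)))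
  have hfor : ContDiff ℝ ∞ fun p ↦ foreignModel (qOfP p) :=
    contDiff_foreignModel.comp ((contDiff_const.mul (contDiff_id.sub contDiff_const)).sub contDiff_const)
  refine contDiff_iff_contDiffAt.2 fun p ↦ ?_
  rcases lt_or_ge p (-(15 / 16)) with h1 | h1
  · exact hlo.contDiffAt.congr_of_eventuallyEq (by
      filter_upwards [Iio_mem_nhds (show p < -(7 / 8) by linarith)] with r hr using templateRaw_of_le hr.le)
  rcases lt_or_ge p (3 / 8) with h2 | h2
  · exact hseg.contDiffAt.congr_of_eventuallyEq (by
      filter_upwards [Ioo_mem_nhds (show (-1 : ℝ) < p by linarith) (show p < 7 / 16 by linarith)] with r hr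
        using templateRaw_of_mem_seg ⟨hr.1.le, hr.2.le⟩)
  rcases lt_or_ge p (7 / 8) with h3 | h3
  · exact harc.contDiffAt.congr_of_eventuallyEq (by
      filter_upwards [Ioo_mem_nhds (show (1 / 4 : ℝ) < p by linarith) (show p < 1 by linarith)] with r hr
        using templateRaw_of_mem_arc ⟨hr.1.le, hr.2.le⟩)
  rcases lt_or_ge p 3 with h4 | h4
  · exact hup.contDiffAt.congr_of_eventuallyEq (by
      filter_upwards [Ioo_mem_nhds (show (5 / 6 : ℝ) < p by linarith) (show p < 6 by linarith)] with r hr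
        using templateRaw_of_mem_upper ⟨hr.1.le, hr.2.le⟩)
  · exact hfor.contDiffAt.congr_of_eventuallyEq (by
      filter_upwards [Ioi_mem_nhds (show (8 / 3 : ℝ) < p by linarith)] with r hr using templateRaw_of_ge hr.le)

/-! ### The template loop (period one) -/

/-- **THE TEMPLATE LOOP** of depth sign `σ`: the raw template rescaled to period `1` and periodised
from the base `-4/18`. [folklore] -/
def template (σ : ℝ) : ℝ → 𝔼 3 := periodise (-(4 / 18)) fun s ↦ templateRaw σ (18 * s)

/-- **The seam of the template**: `templateRaw σ (18 (s + 1)) = templateRaw σ (18 s)` for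
`s ∈ (-6/18, -(7/6)/18)`. [folklore] -/
theorem templateRaw_seam (σ : ℝ) {s : ℝ} (hs : s ∈ Ioo (-(6 / 18) : ℝ) (-(7 / 108))) :
    templateRaw σ (18 * (s + 1)) = templateRaw σ (18 * s) := by
  have h1 : 18 * s ∈ Icc (-6 : ℝ) (-(7 / 6)) := ⟨by linarith [hs.1], by linarith [hs.2]⟩
  rw [show 18 * (s + 1) = 18 * s + 18 by ring, templateRaw_of_ge (by linarith [hs.1]), templateRaw_of_le (by linarith [hs.2]),
    foreign_eq_lowerModel σ h1]

/-- **The template loop is `C^∞`.** [folklore] -/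
theorem contDiff_template (σ : ℝ) : ContDiff ℝ ∞ (template σ) := by
  exact contDiff_periodise (a := -(4 / 18)) (F := fun s ↦ templateRaw σ (18 * s)) (ε := 1 / 18)
    ((contDiff_templateRaw σ).comp (contDiff_const.mul contDiff_id)) (by norm_num)
    fun s hs ↦ templateRaw_seam σ ⟨by linarith [hs.1], by linarith [hs.2]⟩

/-- The template loop is `1`-periodic. [folklore] -/
theorem periodic_template (σ : ℝ) : Periodic (template σ) 1 := periodic_periodise _ _

/-- On the fundamental domain `[-4/18, 14/18)` the template is the rescaled raw template. [folklore] -/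
theorem template_eq {σ s : ℝ} (hs : s ∈ Ico (-(4 / 18) : ℝ) (-(4 / 18) + 1)) : template σ s = templateRaw σ (18 * s) :=
  periodise_eq_self _ _ hs

/-! ### Coordinates of the zones -/

/-- **Coordinates of the bend arc at time one**: with `x = (π/2) annulusCut r (p²)`,
`Y₀ = 1 + (3/4) p (sin x - cos x)`, `Y₁ = p (sin x + cos x)`. [folklore] -/
theorem bendArc_one_apply (σ r p : ℝ) :
    bendArc σ r p 1 0 = 1 + 3 / 4 * (p * Real.sin (π / 2 * annulusCut r (p ^ 2) * 1)) - 3 / 4 * (p * Real.cos (π / 2 * annulusCut r (p ^ 2) * 1)) ∧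
    bendArc σ r p 1 1 = p * Real.sin (π / 2 * annulusCut r (p ^ 2) * 1) + p * Real.cos (π / 2 * annulusCut r (p ^ 2) * 1) := by
  constructor <;> (simp [bendArc, cO, dLo, dHi]; try ring)

/-- **The bend angle lies in `[0, π/2]`.** [folklore] -/
theorem bendAngle_mem (r p : ℝ) : π / 2 * annulusCut r (p ^ 2) * 1 ∈ Icc 0 (π / 2) := by
  have h := annulusCut_mem_Icc r (p ^ 2)
  constructor <;> nlinarith [h.1, h.2, Real.pi_pos]

/-- **Arc zone estimates**: `Y₁ ≥ p`, `Y₀ ≥ 1 - (3/4) p`, and the radius identity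
`(8/9)(Y₀ - 1)² + Y₁²/2 = p²` (`p ≥ 0`). [folklore] -/
theorem bendArc_one_estimates (σ r : ℝ) {p : ℝ} (hp : 0 ≤ p) :
    p ≤ bendArc σ r p 1 1 ∧ 1 - 3 / 4 * p ≤ bendArc σ r p 1 0 ∧
      8 / 9 * (bendArc σ r p 1 0 - 1) ^ 2 + (bendArc σ r p 1 1) ^ 2 / 2 = p ^ 2 := by
  obtain ⟨e0, e1⟩ := bendArc_one_apply σ r p
  set x := π / 2 * annulusCut r (p ^ 2) * 1 with hx
  have hxm := bendAngle_mem r p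
  rw [← hx] at hxm
  have hs : 0 ≤ Real.sin x := Real.sin_nonneg_of_nonneg_of_le_pi hxm.1 (by linarith [hxm.2, Real.pi_pos])
  have hc : 0 ≤ Real.cos x := Real.cos_nonneg_of_mem_Icc ⟨by linarith [hxm.1, Real.pi_pos], hxm.2⟩
  have hc1 : Real.cos x ≤ 1 := Real.cos_le_one x
  have h1 := Real.sin_sq_add_cos_sq x
  have hsc : 1 ≤ Real.sin x + Real.cos x := by nlinarith
  rw [e0, e1]
  refine ⟨by nlinarith, by nlinarith, ?_⟩
  nlinarith

/-- **Lower native zone coordinates** (`p ≤ -7/8`): `Y₀ = levLoOfP p`, `Y₁ ≤ -7/8` with equality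
only at `p = -7/8`. [folklore] -/
theorem lower_zone {σ p : ℝ} (hp : p ≤ -(7 / 8)) :
    (templateRaw σ p) 0 = levLoOfP p ∧ (templateRaw σ p) 1 ≤ -(7 / 8) ∧ (p < -(7 / 8) → (templateRaw σ p) 1 < -(7 / 8)) := by
  rw [templateRaw_of_le hp]
  set α := levLoOfP p with hα
  have hβ := spikeBump_mem_Icc α
  have hα3 : α ≤ 11 / 32 := by rw [hα, levLoOfP]; linarith
  have hs : spikeProfile α = (α - 1 / 4) / (3 / 4) := spikeProfile_of_le (by linarith)
  have e0 : (lowerModel σ α) 0 = α := by simp [lowerModel, modelLo, pt3]; ring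
  have e1 : (lowerModel σ α) 1 = -1 + spikeBump α * spikeProfile α := by simp [lowerModel, modelLo, pt3]; ring
  refine ⟨e0, ?_, fun hlt ↦ ?_⟩
  · rw [e1, hs]
    rcases le_or_gt α (1 / 4) with h1 | h1
    · have : (α - 1 / 4) / (3 / 4) ≤ 0 := by rw [div_le_iff₀ (by norm_num)]; linarith
      nlinarith [hβ.1, hβ.2]
    · have : (α - 1 / 4) / (3 / 4) ≤ 1 / 8 := by rw [div_le_iff₀ (by norm_num)]; linarith
      have h0 : 0 ≤ (α - 1 / 4) / (3 / 4) := by positivity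
      nlinarith [hβ.1, hβ.2]
  · rw [e1, hs]
    have hα' : α < 11 / 32 := by rw [hα, levLoOfP]; linarith
    rcases le_or_gt α (1 / 4) with h1 | h1
    · have : (α - 1 / 4) / (3 / 4) ≤ 0 := by rw [div_le_iff₀ (by norm_num)]; linarith
      nlinarith [hβ.1, hβ.2]
    · have : (α - 1 / 4) / (3 / 4) < 1 / 8 := by rw [div_lt_iff₀ (by norm_num)]; linarith
      have h0 : 0 ≤ (α - 1 / 4) / (3 / 4) := by positivity
      nlinarith [hβ.1, hβ.2]

/-- **Segment zone coordinates** (`p ∈ [-1, 7/16]`): `Y₀ = 1 + (3/4) p`, `Y₁ = p`. [folklore] -/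
theorem seg_zone {σ p : ℝ} (hp : p ∈ Icc (-1 : ℝ) (7 / 16)) : (templateRaw σ p) 0 = 1 + 3 / 4 * p ∧ (templateRaw σ p) 1 = p := by
  rw [templateRaw_of_mem_seg hp]
  constructor <;> (simp [cO, dLo, pt3]; try ring)

/-- **Arc zone coordinates** (`p ∈ [1/4, 1]`): `Y₁ ≥ p`, `Y₀ ≥ 1 - (3/4) p`, radius identity.
[folklore] -/
theorem arc_zone {σ p : ℝ} (hp : p ∈ Icc (1 / 4 : ℝ) 1) :
    p ≤ (templateRaw σ p) 1 ∧ 1 - 3 / 4 * p ≤ (templateRaw σ p) 0 ∧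
      8 / 9 * ((templateRaw σ p) 0 - 1) ^ 2 + ((templateRaw σ p) 1) ^ 2 / 2 = p ^ 2 := by
  rw [templateRaw_of_mem_arc hp]; exact bendArc_one_estimates σ _ (by linarith [hp.1])

/-- **Upper native zone coordinates** (`p ∈ [5/6, 6]`): `Y₀ = levHiOfP p`, `Y₁ ≥ 5/6`. [folklore] -/
theorem upper_zone {σ p : ℝ} (hp : p ∈ Icc (5 / 6 : ℝ) 6) : (templateRaw σ p) 0 = levHiOfP p ∧ 5 / 6 ≤ (templateRaw σ p) 1 := by
  rw [templateRaw_of_mem_upper hp]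
  set α := levHiOfP p with hα
  have hβ := spikeBump_mem_Icc α
  have hα3 : α ≤ 3 / 8 := by rw [hα, levHiOfP]; linarith [hp.1]
  have hs : spikeProfile α = (α - 1 / 4) / (3 / 4) := spikeProfile_of_le (by linarith)
  have e0 : (upperModel σ α) 0 = α := by simp [upperModel, modelHi, pt3]; ring
  have e1 : (upperModel σ α) 1 = 1 - spikeBump α * spikeProfile α := by simp [upperModel, modelHi, pt3]; ring
  refine ⟨e0, ?_⟩
  rw [e1, hs]
  rcases le_or_gt α (1 / 4) with h1 | h1
  · have : (α - 1 / 4) / (3 / 4) ≤ 0 := by rw [div_le_iff₀ (by norm_num)]; linarith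
    nlinarith [hβ.1, hβ.2]
  · have : (α - 1 / 4) / (3 / 4) ≤ 1 / 6 := by rw [div_le_iff₀ (by norm_num)]; linarith
    have h0 : 0 ≤ (α - 1 / 4) / (3 / 4) := by positivity
    nlinarith [hβ.1, hβ.2]

/-- **Foreign zone coordinates** (`p ∈ [4, 14]`): `Y₀ ≤ -2`, `< -2` inside. [folklore] -/
theorem foreign_zone {σ p : ℝ} (hp : p ∈ Icc (4 : ℝ) 14) :
    (templateRaw σ p) 0 ≤ -2 ∧ (p ∈ Ioo (4 : ℝ) 14 → (templateRaw σ p) 0 < -2) := by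
  rw [templateRaw_of_ge (by linarith [hp.1])]
  have hq : qOfP p ∈ Icc (-(15 / 8) : ℝ) (15 / 8) := by simp only [qOfP, mem_Icc]; constructor <;> linarith [hp.1, hp.2]
  obtain ⟨h1, h2⟩ := two_le_hairpin_apply_zero hq
  have e0 : (foreignModel (qOfP p)) 0 = -(hairpin (qOfP p) 0) := by simp [foreignModel, pt3]
  rw [e0]
  refine ⟨by linarith, fun hp' ↦ ?_⟩
  have := h2 ⟨by simp only [qOfP]; linarith [hp'.1], by simp only [qOfP]; linarith [hp'.2]⟩
  linarith

/-- The native zones have `Y₀ ≥ -2`, with equality only at `p = -4` and `p = 4`. [folklore] -/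
theorem native_apply_zero {σ p : ℝ} (hp : p ∈ Icc (-4 : ℝ) 4) :
    -2 ≤ (templateRaw σ p) 0 ∧ (p ∈ Ioo (-4 : ℝ) 4 → -2 < (templateRaw σ p) 0) := by
  rcases le_or_gt p (-(7 / 8)) with h1 | h1
  · obtain ⟨e0, -, -⟩ := lower_zone (σ := σ) (p := p) h1
    rw [e0, levLoOfP]
    exact ⟨by linarith [hp.1], fun hp' ↦ by linarith [hp'.1]⟩
  rcases le_or_gt p (7 / 16) with h2 | h2
  · obtain ⟨e0, -⟩ := seg_zone (σ := σ) (p := p) ⟨by linarith, h2⟩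
    rw [e0]; exact ⟨by linarith, fun _ ↦ by linarith⟩
  rcases le_or_gt p (11 / 12) with h3 | h3
  · obtain ⟨-, e0, -⟩ := arc_zone (σ := σ) (p := p) ⟨by linarith, by linarith⟩
    exact ⟨by linarith, fun _ ↦ by linarith⟩
  · obtain ⟨e0, -⟩ := upper_zone (σ := σ) (p := p) ⟨by linarith, by linarith [hp.2]⟩
    rw [e0, levHiOfP]
    exact ⟨by linarith [hp.2], fun hp' ↦ by linarith [hp'.2]⟩

/-! ### The raw template is injective on a period -/

/-- **THE RAW TEMPLATE IS INJECTIVE ON THE PERIOD `[-4, 14)`.** [folklore] -/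
theorem injOn_templateRaw (σ : ℝ) : InjOn (templateRaw σ) (Ico (-4 : ℝ) 14) := by
  -- reduce to `p ≤ p'` by symmetry
  suffices H : ∀ p ∈ Ico (-4 : ℝ) 14, ∀ p' ∈ Ico (-4 : ℝ) 14, p ≤ p' → templateRaw σ p = templateRaw σ p' → p = p' by
    intro p hp p' hp' he
    rcases le_total p p' with h | h
    · exact H p hp p' hp' h he
    · exact (H p' hp' p hp h he.symm).symm
  intro p hp p' hp' hle he
  have he0 : (templateRaw σ p) 0 = (templateRaw σ p') 0 := by rw [he]
  have he1 : (templateRaw σ p) 1 = (templateRaw σ p') 1 := by rw [he]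
  -- the foreign zone is separated by `Y₀ < -2`
  rcases lt_or_ge 4 p' with hf' | hf'
  · -- `p'` foreign: then `p` foreign too
    have h0' := (foreign_zone (σ := σ) ⟨hf'.le, hp'.2.le⟩).2 ⟨hf', hp'.2⟩
    have hf : 4 < p := by
      by_contra h; push Not at h
      have := (native_apply_zero (σ := σ) ⟨hp.1, h⟩).1
      linarith
    rw [templateRaw_of_ge (by linarith), templateRaw_of_ge (by linarith)] at he
    have hq : ∀ r ∈ Ico (-4 : ℝ) 14, 4 < r → qOfP r ∈ Icc (-(15 / 8) : ℝ) (15 / 8) := fun r hr h4 ↦ by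
      simp only [qOfP, mem_Icc]; constructor <;> linarith [hr.2]
    have heq : hairpin (qOfP p) = hairpin (qOfP p') := by
      have h0 : (foreignModel (qOfP p)) 0 = (foreignModel (qOfP p')) 0 := by rw [he]
      have h1 : (foreignModel (qOfP p)) 1 = (foreignModel (qOfP p')) 1 := by rw [he]
      simp only [foreignModel, pt3] at h0 h1
      ext i; fin_cases i
      · simpa using h0
      · simpa using h1
    have := injOn_hairpin (hq p hp hf) (hq p' hp' hf') heq
    simp only [qOfP] at this; linarith
  -- both native (`p ≤ p' ≤ 4`)
  have hpn : p ≤ 4 := hle.trans hf'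
  rcases le_or_gt p' (-(7 / 8)) with h1' | h1'
  · -- both lower
    obtain ⟨e0, -, -⟩ := lower_zone (σ := σ) (p := p) (hle.trans h1')
    obtain ⟨e0', -, -⟩ := lower_zone (σ := σ) (p := p') h1'
    rw [e0, e0', levLoOfP, levLoOfP] at he0; linarith
  rcases le_or_gt p (-(7 / 8)) with h1 | h1
  · -- `p` lower, `p'` not lower: `Y₁ ≤ -7/8 < Y₁'`
    obtain ⟨-, l1, -⟩ := lower_zone (σ := σ) (p := p) h1
    exfalso
    rcases le_or_gt p' (7 / 16) with h2' | h2'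
    · obtain ⟨-, e1'⟩ := seg_zone (σ := σ) (p := p') ⟨by linarith, h2'⟩; rw [e1'] at he1; linarith
    rcases le_or_gt p' (11 / 12) with h3' | h3'
    · obtain ⟨a1, -, -⟩ := arc_zone (σ := σ) (p := p') ⟨by linarith, by linarith⟩; linarith
    · obtain ⟨-, u1⟩ := upper_zone (σ := σ) (p := p') ⟨by linarith, hf'.trans (by norm_num)⟩; linarith
  rcases le_or_gt p' (7 / 16) with h2' | h2'
  · -- both segment
    obtain ⟨-, e1⟩ := seg_zone (σ := σ) (p := p) ⟨by linarith, hle.trans h2'⟩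
    obtain ⟨-, e1'⟩ := seg_zone (σ := σ) (p := p') ⟨by linarith, h2'⟩
    rw [e1, e1'] at he1; exact he1
  rcases le_or_gt p (7 / 16) with h2 | h2
  · -- `p` segment, `p'` arc or upper: `Y₁ = p ≤ 7/16 < Y₁'`
    obtain ⟨-, e1⟩ := seg_zone (σ := σ) (p := p) ⟨by linarith, h2⟩
    exfalso
    rcases le_or_gt p' (11 / 12) with h3' | h3'
    · obtain ⟨a1, -, -⟩ := arc_zone (σ := σ) (p := p') ⟨by linarith, by linarith⟩; linarith
    · obtain ⟨-, u1⟩ := upper_zone (σ := σ) (p := p') ⟨by linarith, hf'.trans (by norm_num)⟩; linarith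
  rcases le_or_gt p' (11 / 12) with h3' | h3'
  · -- both arc: the radius identity
    obtain ⟨-, -, r1⟩ := arc_zone (σ := σ) (p := p) ⟨by linarith, by linarith⟩
    obtain ⟨-, -, r2⟩ := arc_zone (σ := σ) (p := p') ⟨by linarith, by linarith⟩
    rw [he0, he1] at r1
    have h3 : (p - p') * (p + p') = 0 := by nlinarith
    rcases mul_eq_zero.1 h3 with h | h
    · linarith
    · linarith
  rcases le_or_gt p (11 / 12) with h3 | h3
  · -- `p` arc, `p'` upper: `Y₀ ≥ 5/16 > Y₀'`
    obtain ⟨-, a0, -⟩ := arc_zone (σ := σ) (p := p) ⟨by linarith, by linarith⟩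
    obtain ⟨e0', -⟩ := upper_zone (σ := σ) (p := p') ⟨by linarith, hf'.trans (by norm_num)⟩
    rw [e0', levHiOfP] at he0; exfalso; linarith
  · -- both upper
    obtain ⟨e0, -⟩ := upper_zone (σ := σ) (p := p) ⟨by linarith, hpn.trans (by norm_num)⟩
    obtain ⟨e0', -⟩ := upper_zone (σ := σ) (p := p') ⟨by linarith, hf'.trans (by norm_num)⟩
    rw [e0, e0', levHiOfP, levHiOfP] at he0; linarith

/-- **THE TEMPLATE LOOP IS INJECTIVE MODULO THE PERIOD.** [folklore] -/
theorem template_inj (σ : ℝ) (s t : ℝ) (h : template σ s = template σ t) : ∃ m : ℤ, t - s = m := by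
  obtain ⟨ns, hns⟩ := exists_toIcoMod_one_eq (-(4 / 18)) s
  obtain ⟨nt, hnt⟩ := exists_toIcoMod_one_eq (-(4 / 18)) t
  have hs := toIcoMod_one_mem (-(4 / 18)) s
  have ht := toIcoMod_one_mem (-(4 / 18)) t
  rw [template, periodise, periodise] at h
  have hinj := injOn_templateRaw σ (show 18 * toIcoMod zero_lt_one (-(4 / 18)) s ∈ Ico (-4 : ℝ) 14 from
    ⟨by linarith [hs.1], by linarith [hs.2]⟩) (show 18 * toIcoMod zero_lt_one (-(4 / 18)) t ∈ Ico (-4 : ℝ) 14 from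
    ⟨by linarith [ht.1], by linarith [ht.2]⟩) h
  refine ⟨nt - ns, ?_⟩
  rw [hns, hnt] at hinj
  push_cast; linarith

/-! ### Regularity of the template -/

/-- Coordinates of a derivative. [folklore] -/
theorem hasDerivAt_apply3 {f : ℝ → 𝔼 3} {f' : 𝔼 3} {t : ℝ} (hf : HasDerivAt f f' t) (i : Fin 3) :
    HasDerivAt (fun t ↦ f t i) (f' i) t :=
  (EuclideanSpace.proj i : 𝔼 3 →L[ℝ] ℝ).hasFDerivAt.comp_hasDerivAt t hf

/-- The first coordinate of the lower native model is the level. [folklore] -/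
@[simp] theorem lowerModel_apply_zero (σ α : ℝ) : lowerModel σ α 0 = α := by simp [lowerModel, modelLo, pt3]; ring

/-- The first coordinate of the upper native model is the level. [folklore] -/
@[simp] theorem upperModel_apply_zero (σ α : ℝ) : upperModel σ α 0 = α := by simp [upperModel, modelHi, pt3]; ring

/-- **THE RAW TEMPLATE IS REGULAR.** [folklore] -/
theorem deriv_templateRaw_ne_zero (σ p : ℝ) : deriv (templateRaw σ) p ≠ 0 := by
  have hd := ((contDiff_templateRaw σ).differentiable (by simp) p).hasDerivAt
  set D := deriv (templateRaw σ) p with hD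
  intro h0
  have hc : ∀ i, HasDerivAt (fun p ↦ templateRaw σ p i) 0 p := fun i ↦ by
    have := hasDerivAt_apply3 hd i; rwa [h0, show (0 : 𝔼 3) i = 0 from rfl] at this
  rcases lt_or_ge p (-(15 / 16)) with h1 | h1
  · -- lower zone: the first coordinate is `levLoOfP`, of derivative `3/4`
    have hev : (fun p ↦ templateRaw σ p 0) =ᶠ[𝓝 p] levLoOfP := by
      filter_upwards [Iio_mem_nhds (show p < -(7 / 8) by linarith)] with r hr
      rw [templateRaw_of_le hr.le, lowerModel_apply_zero]
    have h2 : HasDerivAt levLoOfP (3 / 4) p := by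
      have e : levLoOfP = fun x ↦ 1 / 4 + 3 / 4 * (x + 1) := rfl
      rw [e]; simpa using (((hasDerivAt_id p).add_const 1).const_mul (3 / 4 : ℝ)).const_add (1 / 4 : ℝ)
    have := (hc 0).unique (h2.congr_of_eventuallyEq hev)
    norm_num at this
  rcases lt_or_ge p (3 / 8) with h2 | h2
  · -- segment zone: the second coordinate is `p`
    have hev : (fun p ↦ templateRaw σ p 1) =ᶠ[𝓝 p] id := by
      filter_upwards [Ioo_mem_nhds (show (-1 : ℝ) < p by linarith) (show p < 7 / 16 by linarith)] with r hr
      rw [(seg_zone (σ := σ) (p := r) ⟨hr.1.le, hr.2.le⟩).2]; rfl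
    have := (hc 1).unique ((hasDerivAt_id p).congr_of_eventuallyEq hev)
    norm_num at this
  rcases lt_or_ge p (7 / 8) with h3 | h3
  · -- arc zone: the radius identity `g = p²` has derivative `2p ≠ 0`, but `g' = 0`
    set g : ℝ → ℝ := fun p ↦ 8 / 9 * (templateRaw σ p 0 - 1) ^ 2 + (templateRaw σ p 1) ^ 2 / 2 with hg
    have hg0 : HasDerivAt g 0 p := by
      have h4 : HasDerivAt (fun p ↦ 8 / 9 * (templateRaw σ p 0 - 1) ^ 2) 0 p := by
        simpa using (((hc 0).sub_const 1).pow 2).const_mul (8 / 9 : ℝ)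
      have h5 : HasDerivAt (fun p ↦ (templateRaw σ p 1) ^ 2 / 2) 0 p := by
        simpa using ((hc 1).pow 2).div_const 2
      have h6 := h4.add h5
      rw [add_zero] at h6
      exact h6
    have hev : g =ᶠ[𝓝 p] fun p ↦ p ^ 2 := by
      filter_upwards [Ioo_mem_nhds (show (1 / 4 : ℝ) < p by linarith) (show p < 1 by linarith)] with r hr
      exact (arc_zone (σ := σ) (p := r) ⟨hr.1.le, hr.2.le⟩).2.2
    have h6 : HasDerivAt (fun p : ℝ ↦ p ^ 2) (2 * p) p := by simpa using hasDerivAt_pow 2 p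
    have := hg0.unique (h6.congr_of_eventuallyEq hev)
    have : p = 0 := by linarith
    linarith
  rcases lt_or_ge p 3 with h4 | h4
  · -- upper zone: the first coordinate is `levHiOfP`, of derivative `-3/4`
    have hev : (fun p ↦ templateRaw σ p 0) =ᶠ[𝓝 p] levHiOfP := by
      filter_upwards [Ioo_mem_nhds (show (5 / 6 : ℝ) < p by linarith) (show p < 6 by linarith)] with r hr
      rw [(upper_zone (σ := σ) (p := r) ⟨hr.1.le, hr.2.le⟩).1]
    have h5 : HasDerivAt levHiOfP (-(3 / 4)) p := by
      have e : levHiOfP = fun x ↦ 1 / 4 - 3 / 4 * (x - 1) := rfl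
      rw [e]; simpa using (((hasDerivAt_id p).sub_const 1).const_mul (3 / 4 : ℝ)).const_sub (1 / 4 : ℝ)
    have := (hc 0).unique (h5.congr_of_eventuallyEq hev)
    norm_num at this
  · -- foreign zone: the hairpin is regular
    have hq : HasDerivAt qOfP (3 / 8) p := by
      have e : qOfP = fun x ↦ 3 / 8 * (x - 19 / 3) - 1 := rfl
      rw [e]; simpa using (((hasDerivAt_id p).sub_const (19 / 3 : ℝ)).const_mul (3 / 8 : ℝ)).sub_const (1 : ℝ)
    have hh := ((contDiff_hairpin.differentiable (by simp)) (qOfP p)).hasDerivAt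
    have hhc : ∀ i : Fin 2, HasDerivAt (fun p ↦ hairpin (qOfP p) i) ((3 / 8 : ℝ) * deriv hairpin (qOfP p) i) p := fun i ↦ by
      have h1 : HasDerivAt (fun q ↦ hairpin q i) (deriv hairpin (qOfP p) i) (qOfP p) :=
        (EuclideanSpace.proj i : 𝔼 2 →L[ℝ] ℝ).hasFDerivAt.comp_hasDerivAt _ hh
      have := h1.comp p hq
      rwa [mul_comm] at this
    have hz : ∀ i : Fin 2, deriv hairpin (qOfP p) i = 0 := fun i ↦ by
      have hi : ∀ j : Fin 3, (j = 0 ∨ j = 1) → HasDerivAt (fun p ↦ templateRaw σ p j) 0 p := fun j _ ↦ hc j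
      -- coordinate `i` of the foreign model is `-(hairpin q i)`
      have hev : (fun p ↦ templateRaw σ p (Fin.castSucc i)) =ᶠ[𝓝 p] fun p ↦ -(hairpin (qOfP p) i) := by
        filter_upwards [Ioi_mem_nhds (show (8 / 3 : ℝ) < p by linarith)] with r hr
        rw [templateRaw_of_ge hr.le]
        fin_cases i <;> simp [foreignModel, pt3]
      have h7 := ((hhc i).neg).congr_of_eventuallyEq hev
      have := (hc (Fin.castSucc i)).unique h7
      linarith
    exact deriv_hairpin_ne_zero (qOfP p) (by ext i; rw [hz i]; rfl)

/-- **THE TEMPLATE LOOP IS REGULAR.** [folklore] -/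
theorem deriv_template_ne_zero (σ s : ℝ) : deriv (template σ) s ≠ 0 := by
  obtain ⟨n, -, hev⟩ := periodise_eventuallyEq (a := -(4 / 18)) (F := fun s ↦ templateRaw σ (18 * s)) (ε := 1 / 18) (by norm_num)
    (fun r hr ↦ templateRaw_seam σ ⟨by linarith [hr.1], by linarith [hr.2]⟩) s
  have hd : HasDerivAt (fun t : ℝ ↦ templateRaw σ (18 * (t - n))) ((18 : ℝ) • deriv (templateRaw σ) (18 * (s - n))) s := by
    have h1 : HasDerivAt (fun t : ℝ ↦ 18 * (t - n)) 18 s := by simpa using ((hasDerivAt_id s).sub_const (n : ℝ)).const_mul (18 : ℝ)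
    exact (((contDiff_templateRaw σ).differentiable (by simp)) _).hasDerivAt.scomp s h1
  rw [show template σ = periodise (-(4 / 18)) (fun s ↦ templateRaw σ (18 * s)) from rfl, (hd.congr_of_eventuallyEq hev).deriv]
  exact smul_ne_zero (by norm_num) (deriv_templateRaw_ne_zero σ _)

end ModelTemplate

end Literature.Topology.FourManifolds
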